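import Mathlib
import Literature.NumberTheory.EllipticCurves.IwasawaAlgebra

/-!
# STUB-IDEAS k3 g32 — «LEVELS ⟹ Λ_v»: the digit package at `v ∣ 2` from ONE layer, glue PROVED

Stub-ideation sketch (k = 3, gen 32, TECHNIQUE = decomposition with a provable glue) for
`stub_heegnerIndexLowerAtTwo` of the crux `SplitBadTwoLowerHalfOfFacts`
(route `PrintCf2`, item `stmt-BirchSwinnertonDyer-27851`); card `Ideas/stub-heegnerindexloweratwo-k3-g32.md`.

**HONESTY.** BSD is NOT proved by any of this; the crux is NOT proved; the stub is NOT proved; no net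
digit `D_c(key)` is asserted (B45 / E1).  Nothing below mentions an elliptic curve.  What IS proved is
the commutative algebra that turns k3-g31's LEVEL-WISE keyed law (`log₂ U¹(L_n)^{N=1} = 2√u·𝒪_{F_n}` /
`2i·AS_n`, PROVED there at every layer) AT ONE LAYER into STUB-PLAN v6.2's Λ_v-MODULE statements R201′
(the LOWER pointwise package `r_u ∈ 2Λ_vˣ`, B49) and R196⁗ (the exact class `𝔟 = 𝔪_v | Λ_v`), WITHOUT the
coinvariant identification K3_EXACT `M_{Γ_n} ≅ Q_n`, without the torsion census (R202 stays the B51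
cross-check), without trace-coherence of `(AS_n)_n` as a separate input and without a limit argument: ONE
layer decides the class, by Nakayama with a kernel inside `𝔪²` (`ω₁ = T² + 2T ∈ 𝔪_v²`).  The normalised
logarithm is `g := log₂/(2√u)` for ALL six keys (`√u ∈ L_0` is `Γ`-invariant and `σ`-anti-invariant; a unit
for `u ∈ {−1, 3}`, a uniformizer for `u ∈ {±2, ±6}`), so the log frame functional is `Lg_u = 2·g` on the nose.

* §1 (any local ring) `eq_of_map_eq_of_ker_le_smul`: a submodule `N ≤ Y` with the same image as `P`
  under a level map `ev : Y → B` whose kernel lies in `𝔪·P` EQUALS `P` (`P` f.g.).  Corollaries: the FREE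
  shape (`P = ⊤`, kernel in `𝔪Y`) and the `𝔪` shape (`P = 𝔪Y`, kernel in `𝔪²Y`).
* §2 (`Λ₂ = ℤ₂⟦T⟧ = IwasawaAlgebra 2`) `ω_n = (1+T)^{2^n} − 1 ∈ 𝔪^{n+1}` (`omega_mem_pow`), so the
  level-`n` kernel `ω_n·Y` is inside `𝔪²Y` as soon as `n ≥ 1`: `eq_top_of_level` (conductor 8, any layer)
  and `eq_maximalIdeal_smul_top_of_level` (conductor 4, any layer `n ≥ 1`; layer 0 CANNOT decide — §5).
* §3 (receptacle `Y = Λ₂`) the module class `M ≃ 𝔪` / `M ≃ Λ₂` from an INJECTIVE normalised logarithm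
  `g = log₂/(2√u) = Lg_u/2`, the free dual `Hom(M, Λ₂) = Λ₂·g` (coprime pair `2, T` in the range; k2-g30's
  `ideal_dual_existsUnique` is the lemma of record, re-proved here on `M` so the file is self-contained),
  and the GAUGE-FREE digit `Lg_u = (2·unit)·g'` for every dual generator `g'` (`frame_eq_two_unit_smul`)
  — B49's `r_u ∈ 2Λ_vˣ` for all six keys, `𝔟(key) = g'(M) ∈ {Λ_v, 𝔪_v}` gauge-independent.
* §4 (normed `ℚ₂`-algebra layer, k3-g31's vocabulary copied verbatim) the SANDWICH
  `D ⊆ U ⊆ S, f(D) = f(S) = A ⟹ f(U) = A` (universal norms between `(1−σ)U¹(L_n)` and `S_n`) and the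
  DICTIONARY `AS(F) = 2𝒪_F + (φ − 1)𝒪_F = 𝔪_v·𝒪_F` (`artinSchreierBall_eq_maxIdealLattice`; `φ` = a
  Frobenius lift commuting with `σ`): k3-g31's level-1 law IS the hypothesis of §2's conductor-4 theorem.
* §5 kernel-visible SEPARATION WITNESS: `𝔟' = (2, T²)` contains `ω₁`, has the same layer-0 image as `𝔪`
  and the same «floor», yet `T ∉ 𝔟'` — so layer-0 data (and the `M_Γ`-torsion `ℤ/2`, by hand) do NOT pin
  the class/`c`-digit, while the layer-1 LATTICE does (`map_level_one_ne`); in ideal / census currency: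
  `𝔟 + ω_nΛ_v = 𝔪_v` for ONE `n ≥ 1` forces `𝔟 = 𝔪_v` (`eq_maximalIdeal_of_sup_span_omega`) and
  `𝔟 + ω_nΛ_v = Λ_v` for ONE `n` forces `𝔟 = Λ_v` (`eq_top_of_sup_span_omega`) — so k1-g29's census route
  (R202) needs the census entry at layer `1` only, not at an a-priori-unknown deep layer with `ω_n ∈ 𝔟`.
-/

noncomputable section

set_option linter.dupNamespace false

open IsLocalRing

namespace Summit.BirchSwinnertonDyer.BirchSwinnertonDyer.Cruxes.SplitBadTwoLowerHalfOfFacts.LevelsToLambdaK3G32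

/-! ## §1 Nakayama with a deep kernel: a submodule is decided at ONE level -/

section AnyLocalRing

variable {Λ : Type*} [CommRing Λ] [IsLocalRing Λ]
variable {Y : Type*} [AddCommGroup Y] [Module Λ Y]
variable {B : Type*} [AddCommGroup B] [Module Λ B]

/-- If `N ⊔ K = P` with `K ≤ 𝔪·P` and `P` finitely generated, then `N = P` (Nakayama). -/
theorem eq_of_sup_eq_of_le_smul {N K P : Submodule Λ Y} (hP : P.FG)
    (hK : K ≤ maximalIdeal Λ • P) (h : N ⊔ K = P) : N = P := by
  have hN : N ≤ P := h ▸ le_sup_left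
  refine le_antisymm hN ?_
  have hPle : P ≤ N ⊔ maximalIdeal Λ • P :=
    calc P = N ⊔ K := h.symm
      _ ≤ N ⊔ maximalIdeal Λ • P := sup_le_sup_left hK N
  exact Submodule.le_of_le_smul_of_le_jacobson_bot hP (maximalIdeal_le_jacobson ⊥) hPle

/-- **LEVEL READING.** `ev : Y → B` = «restriction to layer `n`» with kernel inside `𝔪·P`; if `N` and `P`
have the same layer-`n` image then `N = P`. -/
theorem eq_of_map_eq_of_ker_le_smul (ev : Y →ₗ[Λ] B) {N P : Submodule Λ Y} (hP : P.FG)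
    (hK : LinearMap.ker ev ≤ maximalIdeal Λ • P) (h : N.map ev = P.map ev) : N = P := by
  have hKP : LinearMap.ker ev ≤ P := hK.trans Submodule.smul_le_right
  have h1 : N ⊔ LinearMap.ker ev = P := by
    have h2 := congrArg (Submodule.comap ev) h
    rw [Submodule.comap_map_eq, Submodule.comap_map_eq, sup_eq_left.mpr hKP] at h2
    exact h2
  exact eq_of_sup_eq_of_le_smul hP hK h1

/-- FREE shape (conductor 8): layer image `= everything`, kernel inside `𝔪Y` ⟹ `N = Y`. -/
theorem eq_top_of_map_eq_top [Module.Finite Λ Y] (ev : Y →ₗ[Λ] B) (hev : Function.Surjective ev)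
    {N : Submodule Λ Y} (hK : LinearMap.ker ev ≤ maximalIdeal Λ • ⊤) (h : N.map ev = ⊤) :
    N = ⊤ := by
  apply eq_of_map_eq_of_ker_le_smul ev Module.Finite.fg_top hK
  rw [h, Submodule.map_top, LinearMap.range_eq_top.mpr hev]

/-- `𝔪` shape (conductor 4): layer image `= 𝔪·(layer)`, kernel inside `𝔪²Y` ⟹ `N = 𝔪Y`. -/
theorem eq_maximalIdeal_smul_top_of_map_eq (ev : Y →ₗ[Λ] B) (hev : Function.Surjective ev)
    {N : Submodule Λ Y} (hP : (maximalIdeal Λ • ⊤ : Submodule Λ Y).FG)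
    (hK : LinearMap.ker ev ≤ maximalIdeal Λ • (maximalIdeal Λ • ⊤))
    (h : N.map ev = maximalIdeal Λ • ⊤) : N = maximalIdeal Λ • ⊤ := by
  apply eq_of_map_eq_of_ker_le_smul ev hP hK
  rw [h, Submodule.map_smul'', Submodule.map_top, LinearMap.range_eq_top.mpr hev]

end AnyLocalRing

/-! ## §2 `Λ_v = ℤ₂⟦T⟧`: the level kernels `ω_n = γ^{2^n} − 1` lie in `𝔪^{n+1}` -/

section Iwasawa

open PowerSeries

/-- `Λ_v = ℤ₂⟦T⟧` (`T = γ − 1`, `γ` = Frobenius of the unramified `ℤ₂`-line at `v`). -/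
abbrev Λ₂ : Type := Literature.NumberTheory.EllipticCurves.IwasawaAlgebra 2

theorem two_eq_C : (2 : Λ₂) = C (2 : ℤ_[2]) := (map_ofNat (C : ℤ_[2] →+* Λ₂) 2).symm

theorem two_ne_zero' : (2 : Λ₂) ≠ 0 := by
  intro h
  have h1 := congrArg (constantCoeff : Λ₂ →+* ℤ_[2]) h
  rw [map_ofNat, map_zero] at h1
  exact two_ne_zero h1

theorem two_mem : (2 : Λ₂) ∈ maximalIdeal Λ₂ := by
  have h := Literature.NumberTheory.EllipticCurves.IwasawaAlgebra.C_p_mem_maximalIdeal 2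
  rw [two_eq_C]
  exact_mod_cast h

theorem X_mem : (X : Λ₂) ∈ maximalIdeal Λ₂ := by
  rw [mem_maximalIdeal, mem_nonunits_iff, PowerSeries.isUnit_iff_constantCoeff]
  simp

/-- `ω_n := γ^{2^n} − 1 = (1 + T)^{2^n} − 1`, the generator of `ker(Λ_v → ℤ₂[Gal(F_n/ℚ₂)])`. -/
def omega (n : ℕ) : Λ₂ := (1 + X) ^ (2 ^ n) - 1

theorem omega_zero : omega 0 = X := by simp [omega]

theorem omega_succ (n : ℕ) : omega (n + 1) = omega n * (omega n + 2) := by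
  simp only [omega, pow_succ, pow_mul]
  ring

/-- `ω_n ∈ 𝔪^{n+1}`; in particular `ω₁ = T² + 2T ∈ 𝔪²`. -/
theorem omega_mem_pow (n : ℕ) : omega n ∈ (maximalIdeal Λ₂) ^ (n + 1) := by
  induction n with
  | zero => simpa [omega_zero] using X_mem
  | succ n ih =>
    rw [omega_succ, pow_succ]
    exact Ideal.mul_mem_mul ih
      (add_mem (Ideal.pow_le_self (Nat.succ_ne_zero n) ih) two_mem)

theorem omega_mem (n : ℕ) : omega n ∈ maximalIdeal Λ₂ :=
  Ideal.pow_le_self (Nat.succ_ne_zero n) (omega_mem_pow n)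

/-- `𝔪 = (2, T)`. -/
theorem maximalIdeal_eq_span : maximalIdeal Λ₂ = Ideal.span {(2 : Λ₂), X} := by
  apply le_antisymm
  · intro f hf
    rw [mem_maximalIdeal, mem_nonunits_iff, PowerSeries.isUnit_iff_constantCoeff] at hf
    have h0 : constantCoeff f ∈ maximalIdeal ℤ_[2] := by
      rw [mem_maximalIdeal, mem_nonunits_iff]; exact hf
    rw [PadicInt.maximalIdeal_eq_span_p, Ideal.mem_span_singleton] at h0
    obtain ⟨a, ha⟩ := h0
    rw [Ideal.mem_span_pair]
    refine ⟨C a, PowerSeries.mk fun k => coeff (k + 1) f, ?_⟩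
    have hf' := (PowerSeries.eq_shift_mul_X_add_const f).symm
    rw [ha] at hf'
    calc C a * 2 + (PowerSeries.mk fun k => coeff (k + 1) f) * X
        = (PowerSeries.mk fun k => coeff (k + 1) f) * X + C ((2 : ℤ_[2]) * a) := by
          rw [map_mul, ← two_eq_C]; ring
      _ = f := by simpa using hf'
  · rw [Ideal.span_le]
    intro x hx
    rcases hx with rfl | hx
    · exact two_mem
    · rw [Set.mem_singleton_iff] at hx; subst hx; exact X_mem

variable {Y : Type*} [AddCommGroup Y] [Module Λ₂ Y] [Module.Finite Λ₂ Y]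
variable {B : Type*} [AddCommGroup B] [Module Λ₂ B]

open Pointwise in
/-- `𝔪_v·B = 2B + T·B` for any `Λ_v`-module `B` (e.g. `B = 𝒪_{F_n}`, `T` acting as `γ − 1`). -/
theorem maximalIdeal_smul_top_eq :
    maximalIdeal Λ₂ • (⊤ : Submodule Λ₂ B) = (2 : Λ₂) • ⊤ ⊔ (X : Λ₂) • ⊤ := by
  rw [maximalIdeal_eq_span, Ideal.span_insert, Submodule.sup_smul,
    Submodule.ideal_span_singleton_smul, Submodule.ideal_span_singleton_smul]

open Pointwise in
/-- MEMBERSHIP FORM of the conductor-4 hypothesis: `b ∈ 𝔪_v·𝒪_F ⟺ b = 2x + (γ − 1)c` — this is §4's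
set `maxIdealLattice` once `T` acts on `𝒪_{F_n}` as `φ − 1` (the instantiation's definition of the action). -/
theorem mem_maximalIdeal_smul_top_iff (b : B) :
    b ∈ maximalIdeal Λ₂ • (⊤ : Submodule Λ₂ B) ↔ ∃ x c : B, b = (2 : Λ₂) • x + (X : Λ₂) • c := by
  rw [maximalIdeal_smul_top_eq, Submodule.mem_sup]
  constructor
  · rintro ⟨y, hy, z, hz, rfl⟩
    rw [Submodule.mem_smul_pointwise_iff_exists] at hy hz
    obtain ⟨x, -, rfl⟩ := hy
    obtain ⟨c, -, rfl⟩ := hz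
    exact ⟨x, c, rfl⟩
  · rintro ⟨x, c, rfl⟩
    exact ⟨_, Submodule.smul_mem_pointwise_smul _ _ _ Submodule.mem_top,
      _, Submodule.smul_mem_pointwise_smul _ _ _ Submodule.mem_top, rfl⟩

/-- **CONDUCTOR-8 CLASS (keys `±2, ±6`, any layer `n`, e.g. `n = 0`):** if the layer-`n` image of
`N = g(M)` is all of `𝒪_{F_n}` (⟸ k3-g31 `keyedLawEight_table`: it contains `(log/2√u)((1+√u)^{1−σ})`, a
unit) then `N = Y`: `M(key)_v` FREE, `𝔟 = Λ_v`, `c = 0`. -/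
theorem eq_top_of_level (ev : Y →ₗ[Λ₂] B) (hev : Function.Surjective ev) (n : ℕ)
    (hker : LinearMap.ker ev ≤ Ideal.span {omega n} • ⊤) {N : Submodule Λ₂ Y}
    (h : N.map ev = ⊤) : N = ⊤ :=
  eq_top_of_map_eq_top ev hev
    (hker.trans (Submodule.smul_mono_left ((Ideal.span_singleton_le_iff_mem _).mpr (omega_mem n)))) h

/-- **CONDUCTOR-4 CLASS (keys `−1, 3`, any layer `n ≥ 1`, e.g. `n = 1` where `L_1 = F_1(i)` for BOTH
keys):** if the layer-`n` image of `N = g(M)` is `𝔪_v·𝒪_{F_n}` (`= AS_n`, §4; ⟸ k3-g31 `keyedLawFour` +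
`imLawFour` at `L_n` + the sandwich) then `N = 𝔪_v·Y`: `M(key)_v ≅ 𝔪_v`, `𝔟 = 𝔪_v`, `c = 1` —
R196⁗'s conductor-4 half.  Layer 0 is EXCLUDED (`ω₀ = T ∉ 𝔪²`; §5 shows it genuinely cannot decide). -/
theorem eq_maximalIdeal_smul_top_of_level (ev : Y →ₗ[Λ₂] B) (hev : Function.Surjective ev)
    (n : ℕ) (hn : 1 ≤ n) (hker : LinearMap.ker ev ≤ Ideal.span {omega n} • ⊤)
    {N : Submodule Λ₂ Y} (h : N.map ev = maximalIdeal Λ₂ • ⊤) :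
    N = maximalIdeal Λ₂ • ⊤ := by
  have hfg : (maximalIdeal Λ₂ • ⊤ : Submodule Λ₂ Y).FG := by
    haveI : IsNoetherian Λ₂ Y := isNoetherian_of_isNoetherianRing_of_finite Λ₂ Y
    exact IsNoetherian.noetherian _
  apply eq_maximalIdeal_smul_top_of_map_eq ev hev hfg ?_ h
  calc LinearMap.ker ev ≤ Ideal.span {omega n} • ⊤ := hker
    _ ≤ (maximalIdeal Λ₂ ^ (n + 1)) • ⊤ :=
        Submodule.smul_mono_left ((Ideal.span_singleton_le_iff_mem _).mpr (omega_mem_pow n))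
    _ ≤ (maximalIdeal Λ₂ ^ 2) • ⊤ := Submodule.smul_mono_left (Ideal.pow_le_pow_right (by omega))
    _ = maximalIdeal Λ₂ • (maximalIdeal Λ₂ • ⊤) := by rw [pow_two, Submodule.mul_smul]

/-! ## §3 Receptacle `Y = Λ_v`: module class, free dual, and the gauge-free digit `r_u ∈ 2Λ_vˣ` -/

theorem maximalIdeal_smul_top :
    maximalIdeal Λ₂ • (⊤ : Submodule Λ₂ Λ₂) = (maximalIdeal Λ₂ : Submodule Λ₂ Λ₂) := by
  rw [Ideal.smul_eq_mul, Ideal.mul_top]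

variable {M : Type*} [AddCommGroup M] [Module Λ₂ M]

/-- Conductor 8 with `Y = Λ_v`: `g(M) = Λ_v`. -/
theorem range_eq_top_of_level (g : M →ₗ[Λ₂] Λ₂) (ev : Λ₂ →ₗ[Λ₂] B) (hev : Function.Surjective ev)
    (n : ℕ) (hker : LinearMap.ker ev ≤ Ideal.span {omega n} • ⊤)
    (h : (LinearMap.range g).map ev = ⊤) : LinearMap.range g = ⊤ :=
  eq_top_of_level ev hev n hker h

/-- Conductor 4 with `Y = Λ_v`: `g(M) = 𝔪_v`. -/
theorem range_eq_maximalIdeal_of_level (g : M →ₗ[Λ₂] Λ₂) (ev : Λ₂ →ₗ[Λ₂] B)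
    (hev : Function.Surjective ev) (n : ℕ) (hn : 1 ≤ n)
    (hker : LinearMap.ker ev ≤ Ideal.span {omega n} • ⊤)
    (h : (LinearMap.range g).map ev = maximalIdeal Λ₂ • ⊤) :
    LinearMap.range g = (maximalIdeal Λ₂ : Submodule Λ₂ Λ₂) := by
  rw [← maximalIdeal_smul_top]
  exact eq_maximalIdeal_smul_top_of_level ev hev n hn hker h

/-- MODULE CLASS, conductor 4: an injective `g` with `g(M) = 𝔪_v` is an isomorphism `M ≅ 𝔪_v`
(non-freeness of `M(key)_v` becomes an OUTPUT, not an input). -/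
def equivMaximalIdeal (g : M →ₗ[Λ₂] Λ₂) (hg : Function.Injective g)
    (h : LinearMap.range g = (maximalIdeal Λ₂ : Submodule Λ₂ Λ₂)) :
    M ≃ₗ[Λ₂] (maximalIdeal Λ₂ : Submodule Λ₂ Λ₂) :=
  (LinearEquiv.ofInjective g hg).trans (LinearEquiv.ofEq _ _ h)

/-- MODULE CLASS, conductor 8: `M ≅ Λ_v` free of rank one. -/
def equivTop (g : M →ₗ[Λ₂] Λ₂) (hg : Function.Injective g) (h : LinearMap.range g = ⊤) :
    M ≃ₗ[Λ₂] Λ₂ :=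
  LinearEquiv.ofBijective g ⟨hg, LinearMap.range_eq_top.mp h⟩

/-- `T ∣ 2y ⟹ T ∣ y` in `ℤ₂⟦T⟧` (`T` prime, `T ∤ 2`). -/
theorem X_dvd_of_X_dvd_two_mul {y : Λ₂} (h : (X : Λ₂) ∣ 2 * y) : (X : Λ₂) ∣ y := by
  rcases PowerSeries.X_prime.dvd_or_dvd h with h2 | hy
  · exfalso
    rw [PowerSeries.X_dvd_iff, map_ofNat] at h2
    exact two_ne_zero h2
  · exact hy

/-- **FREE DUAL `Hom_Λ(M, Λ_v) = Λ_v·g`** for an injective `g` whose range contains the coprime pair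
`2, T` — both classes (`g(M) = 𝔪_v` or `Λ_v`).  (k2-g30 `ideal_dual_existsUnique` is the version on
ideals; this is the same argument transported to `M`.) -/
theorem dual_existsUnique (g : M →ₗ[Λ₂] Λ₂) (hg : Function.Injective g)
    (h2 : (2 : Λ₂) ∈ LinearMap.range g) (hX : (X : Λ₂) ∈ LinearMap.range g)
    (f : M →ₗ[Λ₂] Λ₂) : ∃! r : Λ₂, f = r • g := by
  obtain ⟨a, ha⟩ := h2
  obtain ⟨b, hb⟩ := hX
  have hab : (X : Λ₂) • a = (2 : Λ₂) • b := hg (by rw [map_smul, map_smul, ha, hb, smul_eq_mul,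
    smul_eq_mul, mul_comm])
  have key : (X : Λ₂) * f a = 2 * f b := by
    have h1 := congrArg f hab
    simpa only [map_smul, smul_eq_mul] using h1
  obtain ⟨s, hs⟩ : (X : Λ₂) ∣ f b := X_dvd_of_X_dvd_two_mul ⟨f a, key.symm⟩
  have hfa : f a = 2 * s := by
    have h1 : (X : Λ₂) * f a = X * (2 * s) := by rw [key, hs]; ring
    exact mul_left_cancel₀ PowerSeries.X_ne_zero h1
  have hm : ∀ m : M, g m • a = (2 : Λ₂) • m := fun m =>
    hg (by rw [map_smul, map_smul, ha, smul_eq_mul, smul_eq_mul, mul_comm])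
  refine ⟨s, ?_, ?_⟩
  · refine LinearMap.ext fun m => ?_
    have h1 := congrArg f (hm m)
    simp only [map_smul, smul_eq_mul, hfa] at h1
    -- h1 : g m * (2 * s) = 2 * f m
    apply mul_left_cancel₀ two_ne_zero'
    rw [← h1, LinearMap.smul_apply, smul_eq_mul]
    ring
  · intro r hr
    have h1 := congrArg (fun φ : M →ₗ[Λ₂] Λ₂ => φ a) hr
    simp only [LinearMap.smul_apply, smul_eq_mul, ha, hfa] at h1
    -- h1 : 2 * s = r * 2
    apply mul_right_cancel₀ two_ne_zero'
    rw [← h1, mul_comm]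

/-- Both class theorems feed `dual_existsUnique`: the coprime pair is in the range. -/
theorem two_mem_range_and_X_mem_range (g : M →ₗ[Λ₂] Λ₂)
    (h : LinearMap.range g = (maximalIdeal Λ₂ : Submodule Λ₂ Λ₂) ∨ LinearMap.range g = ⊤) :
    (2 : Λ₂) ∈ LinearMap.range g ∧ (X : Λ₂) ∈ LinearMap.range g := by
  rcases h with h | h
  · rw [h]; exact ⟨two_mem, X_mem⟩
  · rw [h]; exact ⟨Submodule.mem_top, Submodule.mem_top⟩

/-- A dual generator does not vanish at the preimage of `2`; packaged as `g ≠ 0`. -/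
theorem ne_zero_of_two_mem_range (g : M →ₗ[Λ₂] Λ₂) (h2 : (2 : Λ₂) ∈ LinearMap.range g) : g ≠ 0 := by
  obtain ⟨a, ha⟩ := h2
  intro h0
  rw [h0, LinearMap.zero_apply] at ha
  exact two_ne_zero' ha.symm

/-- **THE GAUGE-FREE DIGIT (B49's `r_u ∈ 2Λ_vˣ`).** If the frame functional is `Lg = 2·g` for ONE dual
generator `g` (§3: `g = log₂/(2√u)` generates the dual in both classes), then for EVERY dual generator `g'`
one has `Lg = (2·w)·g'` with `w ∈ Λ_vˣ`: the scalar `r_u` lies in `2Λ_vˣ` in any gauge, `j ≡ 1`. -/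
theorem frame_eq_two_unit_smul {g g' Lg : M →ₗ[Λ₂] Λ₂} (hg0 : g ≠ 0)
    (hgen : ∀ f : M →ₗ[Λ₂] Λ₂, ∃! r : Λ₂, f = r • g)
    (hgen' : ∀ f : M →ₗ[Λ₂] Λ₂, ∃! r : Λ₂, f = r • g')
    (hLg : Lg = (2 : Λ₂) • g) : ∃ w : Λ₂ˣ, Lg = ((2 : Λ₂) * w) • g' := by
  obtain ⟨r, hr, -⟩ := hgen' g
  obtain ⟨r', hr', -⟩ := hgen g'
  have hrr : g = (r * r') • g := by
    conv_lhs => rw [hr, hr', smul_smul]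
  obtain ⟨m, hm⟩ : ∃ m, g m ≠ 0 := by
    by_contra hall
    push Not at hall
    exact hg0 (LinearMap.ext hall)
  have h1 : (r * r') * g m = g m := by
    have := congrArg (fun φ : M →ₗ[Λ₂] Λ₂ => φ m) hrr
    simpa [LinearMap.smul_apply, smul_eq_mul] using this.symm
  have hunit : r * r' = 1 := by
    have h2 : (r * r') * g m = 1 * g m := by rw [h1, one_mul]
    exact mul_right_cancel₀ hm h2
  refine ⟨(Units.mkOfMulEqOne r r' hunit), ?_⟩
  rw [hLg, hr, smul_smul]
  rfl

/-- `𝔟(key) := g'(M)` does not depend on the gauge: a unit rescaling has the same range. -/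
theorem range_unit_smul (g : M →ₗ[Λ₂] Λ₂) (w : Λ₂ˣ) :
    LinearMap.range ((w : Λ₂) • g) = LinearMap.range g := by
  apply le_antisymm
  · rintro x ⟨m, rfl⟩
    rw [LinearMap.smul_apply]
    exact Submodule.smul_mem _ _ (LinearMap.mem_range_self g m)
  · rintro x ⟨m, rfl⟩
    refine ⟨(↑w⁻¹ : Λ₂) • m, ?_⟩
    rw [LinearMap.smul_apply, map_smul, smul_smul, Units.mul_inv, one_smul]

/-- **R201′ ⊕ R196⁗, conductor 4, ASSEMBLED (receptacle `Y = Λ_v`).**  From: `g` injective (S-T),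
a layer map `ev` at a layer `n ≥ 1` with kernel `ω_n·Λ_v` (S-Y), and the layer-`n` lattice
`ev(g(M)) = 𝔪_v·𝒪_{F_n}` (S-1 = k3-g31 + sandwich + §4 dictionary):
`g(M) = 𝔪_v` (`c = 1`), `M ≅ 𝔪_v`, and `g` generates `Hom(M, Λ_v)` (so `Lg_u = 2g` has `r_u = 2`). -/
theorem conductorFour_package (g : M →ₗ[Λ₂] Λ₂) (hg : Function.Injective g)
    (ev : Λ₂ →ₗ[Λ₂] B) (hev : Function.Surjective ev) (n : ℕ) (hn : 1 ≤ n)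
    (hker : LinearMap.ker ev ≤ Ideal.span {omega n} • ⊤)
    (h : (LinearMap.range g).map ev = maximalIdeal Λ₂ • ⊤) :
    LinearMap.range g = (maximalIdeal Λ₂ : Submodule Λ₂ Λ₂) ∧
      Nonempty (M ≃ₗ[Λ₂] (maximalIdeal Λ₂ : Submodule Λ₂ Λ₂)) ∧
      ∀ f : M →ₗ[Λ₂] Λ₂, ∃! r : Λ₂, f = r • g := by
  have hr := range_eq_maximalIdeal_of_level g ev hev n hn hker h
  have hp := two_mem_range_and_X_mem_range g (Or.inl hr)
  exact ⟨hr, ⟨equivMaximalIdeal g hg hr⟩, dual_existsUnique g hg hp.1 hp.2⟩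

/-- **R201′ ⊕ R196⁗, conductor 8, ASSEMBLED (receptacle `Y = Λ_v`).** From `g` injective, a layer map at any layer
`n` (e.g. `0`) and `ev(g(M)) = 𝒪_{F_n}` (k3-g31 `keyedLawEight_table` + layer-0 witness + sandwich):
`g(M) = Λ_v` (`c = 0`), `M ≅ Λ_v` free, `g` generates the dual (`r_u = 2`). -/
theorem conductorEight_package (g : M →ₗ[Λ₂] Λ₂) (hg : Function.Injective g)
    (ev : Λ₂ →ₗ[Λ₂] B) (hev : Function.Surjective ev) (n : ℕ)
    (hker : LinearMap.ker ev ≤ Ideal.span {omega n} • ⊤)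
    (h : (LinearMap.range g).map ev = ⊤) :
    LinearMap.range g = ⊤ ∧ Nonempty (M ≃ₗ[Λ₂] Λ₂) ∧
      ∀ f : M →ₗ[Λ₂] Λ₂, ∃! r : Λ₂, f = r • g := by
  have hr := range_eq_top_of_level g ev hev n hker h
  have hp := two_mem_range_and_X_mem_range g (Or.inr hr)
  exact ⟨hr, ⟨equivTop g hg hr⟩, dual_existsUnique g hg hp.1 hp.2⟩

/-! ## §5 Separation witness: layer 0 (and `M_Γ`-torsion) cannot decide the class; layer 1 does -/

/-- The competitor `𝔟' = (2, T²)`: finite colength, non-principal, `𝔟'/T𝔟' ≅ ℤ₂ ⊕ ℤ/2` like `𝔪`. -/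
def bPrime : Ideal Λ₂ := Ideal.span {(2 : Λ₂), X ^ 2}

theorem omega_one_eq : omega 1 = X ^ 2 + 2 * X := by
  simp only [omega, pow_one]
  ring

/-- `ω₁ ∈ 𝔟'`: the competitor survives the passage to layer 1 as a KERNEL condition … -/
theorem omega_one_mem_bPrime : omega 1 ∈ bPrime := by
  rw [omega_one_eq, bPrime, Ideal.mem_span_pair]
  exact ⟨X, 1, by ring⟩

/-- … it has the same «floor» (`𝔟' ≤ 𝔪`) … -/
theorem bPrime_le_maximalIdeal : bPrime ≤ maximalIdeal Λ₂ := by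
  rw [bPrime, Ideal.span_le]
  intro x hx
  rcases hx with rfl | hx
  · exact two_mem
  · rw [Set.mem_singleton_iff] at hx; subst hx
    exact (maximalIdeal Λ₂).pow_mem_of_mem X_mem 2 (by norm_num)

/-- … and the same LAYER-0 image as `𝔪` (`𝔟' + TΛ = 𝔪 + TΛ = 𝔪`) … -/
theorem bPrime_sup_span_X : bPrime ⊔ Ideal.span {(X : Λ₂)} = maximalIdeal Λ₂ := by
  apply le_antisymm
  · exact sup_le bPrime_le_maximalIdeal ((Ideal.span_singleton_le_iff_mem _).mpr X_mem)
  · rw [maximalIdeal_eq_span, Ideal.span_le]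
    intro x hx
    rcases hx with rfl | hx
    · exact Submodule.mem_sup_left (Ideal.subset_span (by simp))
    · rw [Set.mem_singleton_iff] at hx; subst hx
      exact Submodule.mem_sup_right (Ideal.subset_span rfl)

theorem maximalIdeal_sup_span_X : maximalIdeal Λ₂ ⊔ Ideal.span {(X : Λ₂)} = maximalIdeal Λ₂ :=
  sup_eq_left.mpr ((Ideal.span_singleton_le_iff_mem _).mpr X_mem)

/-- LAYER 0 DOES NOT SEPARATE: `𝔟'` and `𝔪` have the same image modulo `ω₀ = T`. -/
theorem map_level_zero_eq :
    bPrime.map (Ideal.Quotient.mk (Ideal.span {omega 0})) =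
      (maximalIdeal Λ₂).map (Ideal.Quotient.mk (Ideal.span {omega 0})) := by
  have key : ∀ I J : Ideal Λ₂, I ⊔ Ideal.span {omega 0} = J ⊔ Ideal.span {omega 0} →
      I.map (Ideal.Quotient.mk (Ideal.span {omega 0})) =
        J.map (Ideal.Quotient.mk (Ideal.span {omega 0})) := by
    intro I J hIJ
    have h1 := congrArg (Ideal.map (Ideal.Quotient.mk (Ideal.span {omega 0}))) hIJ
    simpa [Ideal.map_sup, Ideal.map_quotient_self] using h1
  apply key
  rw [omega_zero, bPrime_sup_span_X, maximalIdeal_sup_span_X]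

/-- … yet `T ∉ 𝔟'`, so `𝔟' ≠ 𝔪` (different `c`-digit: `length Λ/𝔟' = 2`). -/
theorem X_not_mem_bPrime : (X : Λ₂) ∉ bPrime := by
  intro h
  rw [bPrime, Ideal.mem_span_pair] at h
  obtain ⟨a, b, hab⟩ := h
  have h1 := congrArg (coeff (R := ℤ_[2]) 1) hab
  rw [map_add, two_eq_C, PowerSeries.coeff_mul_C, PowerSeries.coeff_mul_X_pow',
    PowerSeries.coeff_one_X] at h1
  simp at h1
  have h2 : (2 : ℤ_[2]) ∣ 1 := Dvd.intro_left _ h1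
  have hp : Prime (2 : ℤ_[2]) := by simpa using PadicInt.prime_p (p := 2)
  exact hp.not_dvd_one h2

theorem bPrime_ne_maximalIdeal : bPrime ≠ maximalIdeal Λ₂ := fun h =>
  X_not_mem_bPrime (h ▸ X_mem)

/-- B51 CROSS-CHECK in census form: `𝔪 + ω_nΛ = 𝔪` at every layer (census `|Λ/𝔪| = 2, 2, 2, …`) while
`𝔟' + ω₁Λ = 𝔟'` (census `|Λ/𝔟'| = 4` at layer 1) — the census, too, separates `𝔟'` from `𝔪` at layer 1
and not at layer 0 (`𝔟' + ω₀Λ = 𝔪`, `map_level_zero_eq`). -/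
theorem maximalIdeal_sup_span_omega (n : ℕ) :
    maximalIdeal Λ₂ ⊔ Ideal.span {omega n} = maximalIdeal Λ₂ :=
  sup_eq_left.mpr ((Ideal.span_singleton_le_iff_mem _).mpr (omega_mem n))

theorem bPrime_sup_span_omega_one : bPrime ⊔ Ideal.span {omega 1} = bPrime :=
  sup_eq_left.mpr ((Ideal.span_singleton_le_iff_mem _).mpr omega_one_mem_bPrime)

/-- **ONE LAYER `n ≥ 1` DECIDES THE CLASS `𝔪_v` — ideal / census form (upgrades the PRIMARY route R202 of
STUB-PLAN v6.2):** an ideal `𝔟` with `𝔟 + ω_nΛ_v = 𝔪_v` for SOME `n ≥ 1` IS `𝔪_v` (Nakayama, `ω_n ∈ 𝔪^{n+1} ⊆ 𝔪²`).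
Composed with k1-g29 `eq_maximalIdeal_of_index_eq` (an index-`2` ideal of `Λ_v` is `𝔪_v`), the SINGLE census
entry `|Λ_v/(𝔟 + ω₁Λ_v)| = 2` at layer ONE returns `𝔟 = 𝔪_v`; k1-g29 `eq_maximalIdeal_of_torsionCount` needs
`ω_n ∈ 𝔟`, i.e. an a-priori-unknown deep layer and K3_EXACT uniformly in `n`.  Layer `0` is excluded and
cannot work: `𝔟' + ω₀Λ_v = 𝔪_v` although `𝔟' ≠ 𝔪_v` (`bPrime_sup_span_X`, `bPrime_ne_maximalIdeal`). -/
theorem eq_maximalIdeal_of_sup_span_omega {I : Ideal Λ₂} {n : ℕ} (hn : 1 ≤ n)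
    (h : I ⊔ Ideal.span {omega n} = maximalIdeal Λ₂) : I = maximalIdeal Λ₂ := by
  have hfg : (maximalIdeal Λ₂ : Submodule Λ₂ Λ₂).FG := IsNoetherian.noetherian _
  have h2 : omega n ∈ maximalIdeal Λ₂ * maximalIdeal Λ₂ := by
    rw [← pow_two]
    exact Ideal.pow_le_pow_right (by omega) (omega_mem_pow n)
  exact eq_of_sup_eq_of_le_smul hfg ((Ideal.span_singleton_le_iff_mem _).mpr h2) h

/-- Layer-1 instance (the one the card uses: `ω₁ = T² + 2T`). -/
theorem eq_maximalIdeal_of_sup_span_omega_one {I : Ideal Λ₂}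
    (h : I ⊔ Ideal.span {omega 1} = maximalIdeal Λ₂) : I = maximalIdeal Λ₂ :=
  eq_maximalIdeal_of_sup_span_omega le_rfl h

/-- FREE class from ONE layer (any `n`, census entry `1`): `𝔟 + ω_nΛ_v = Λ_v ⟹ 𝔟 = Λ_v` (`ω_n ∈ 𝔪_v`). -/
theorem eq_top_of_sup_span_omega {I : Ideal Λ₂} {n : ℕ}
    (h : I ⊔ Ideal.span {omega n} = ⊤) : I = ⊤ := by
  have hfg : (⊤ : Submodule Λ₂ Λ₂).FG := IsNoetherian.noetherian _
  refine eq_of_sup_eq_of_le_smul hfg ?_ h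
  rw [maximalIdeal_smul_top]
  exact (Ideal.span_singleton_le_iff_mem _).mpr (omega_mem n)

/-- …whereas at layer `0` the same equation has the second solution `𝔟' = (2, T²)`. -/
theorem exists_ne_maximalIdeal_sup_span_omega_zero :
    ∃ I : Ideal Λ₂, I ≠ maximalIdeal Λ₂ ∧ I ⊔ Ideal.span {omega 0} = maximalIdeal Λ₂ :=
  ⟨bPrime, bPrime_ne_maximalIdeal, by rw [omega_zero]; exact bPrime_sup_span_X⟩

/-- **LAYER 1 SEPARATES** (kernel form of the card's located structural fact for R196⁗'s typer): under ANY
layer-1 reading `ev` (surjective, kernel inside `ω₁·Λ_v`, `ω₁ = T² + 2T`) the images of `𝔟'` and of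
`𝔪 = 𝔪·Λ_v` DIFFER — by §2's theorem, equality would force `𝔟' = 𝔪`.  So the layer-1 LATTICE (k3-g31 at
`n = 1`), not layer-0 data, is what pins `c = 1`. -/
theorem map_level_one_ne (ev : Λ₂ →ₗ[Λ₂] B) (hev : Function.Surjective ev)
    (hker : LinearMap.ker ev ≤ Ideal.span {omega 1} • ⊤) :
    Submodule.map ev (bPrime : Submodule Λ₂ Λ₂) ≠ maximalIdeal Λ₂ • (⊤ : Submodule Λ₂ B) := by
  intro h
  apply bPrime_ne_maximalIdeal
  have h1 := eq_maximalIdeal_smul_top_of_level (Y := Λ₂) ev hev 1 le_rfl hker h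
  rw [maximalIdeal_smul_top] at h1
  exact h1

end Iwasawa

/-! ## §4 The normed layer: sandwich for universal norms and the dictionary `AS(F) = 𝔪_v·𝒪_F` -/

section LevelOne

/-- SANDWICH: `D ⊆ U ⊆ S` and `f(D) = f(S) = A` force `f(U) = A`.  Use: `D = (1−σ)U¹(L_n)` (⊆ universal
norms by unramified norm-surjectivity, S-N), `U = Im(M(key)_v → S_n)`, `S = S_n = U¹(L_n)^{N=1}`,
`f = log₂`, `A = 2i·AS_n` (k3-g31 `imLawFour` for `D`, `keyedLawFour` for `S`). -/
theorem image_eq_of_sandwich {α β : Type*} {f : α → β} {D U S : Set α} {A : Set β}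
    (hDU : D ⊆ U) (hUS : U ⊆ S) (hD : f '' D = A) (hS : f '' S = A) : f '' U = A :=
  Set.Subset.antisymm (hS ▸ Set.image_mono hUS) (hD ▸ Set.image_mono hDU)

variable {L : Type*} [NontriviallyNormedField L] [NormedAlgebra ℚ_[2] L] [IsUltrametricDist L]

/-- `𝒪_F`-ball of the fixed field of `σ` (verbatim k3-g31 §0). -/
def fixedBall (σ : L ≃ₐ[ℚ_[2]] L) (r : ℝ) : Set L := {a | σ a = a ∧ ‖a‖ ≤ r}

/-- The Artin–Schreier lattice `AS(F) = {b ∈ 𝒪_F | b̄ ∈ ℘(k_F)}` (verbatim k3-g31 §0). -/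
def artinSchreierBall (σ : L ≃ₐ[ℚ_[2]] L) : Set L :=
  {b | σ b = b ∧ ∃ c : L, σ c = c ∧ ‖c‖ ≤ 1 ∧ ‖b - (c ^ 2 + c)‖ < 1}

/-- `𝔪_v·𝒪_F := 2𝒪_F + (φ − 1)𝒪_F` where `φ` is a Frobenius lift on `F` (the action of `γ ∈ Γ_v`):
the layer image of `𝔪_v·Y` in the module language of §2. -/
def maxIdealLattice (σ φ : L ≃ₐ[ℚ_[2]] L) : Set L :=
  {b | ∃ x ∈ fixedBall σ 1, ∃ c ∈ fixedBall σ 1, b = 2 * x + (φ c - c)}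

omit [IsUltrametricDist L] in
theorem norm_two : ‖(2 : L)‖ = 2⁻¹ := by
  have h := norm_algebraMap' L (2 : ℚ_[2])
  rw [map_ofNat] at h
  rw [h]
  have h2 := Padic.norm_p (p := 2)
  exact_mod_cast h2

omit [IsUltrametricDist L] in
theorem norm_two_lt_one : ‖(2 : L)‖ < 1 := by rw [norm_two]; norm_num

omit [IsUltrametricDist L] in
theorem two_ne_zero_L : (2 : L) ≠ 0 := by
  rw [← norm_pos_iff, norm_two]; norm_num

/-- **DICTIONARY `AS(F) = 𝔪_v·𝒪_F`.** Hypotheses: `σ` and `φ` commute; `φ` lifts the residue Frobenius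
on `𝒪_F` (`‖φc − c²‖ < 1`); `F` is UNRAMIFIED over `ℚ₂` in the form «a fixed element of norm `< 1` has norm
`≤ ‖2‖`» (k3-g31 `CondFourFrame.norm_le_sq_of_fixed` supplies exactly this).  Since `℘ = φ̄ − 1` on `k_F`,
this is two lines of residue arithmetic; it identifies k3-g31's level law with §2's hypothesis. -/
theorem artinSchreierBall_eq_maxIdealLattice (σ φ : L ≃ₐ[ℚ_[2]] L)
    (hcomm : ∀ x : L, σ (φ x) = φ (σ x))
    (hfrob : ∀ c : L, σ c = c → ‖c‖ ≤ 1 → ‖φ c - c ^ 2‖ < 1)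
    (hunr : ∀ y : L, σ y = y → ‖y‖ < 1 → ‖y‖ ≤ ‖(2 : L)‖) :
    artinSchreierBall σ = maxIdealLattice σ φ := by
  ext b
  constructor
  · rintro ⟨hσb, c, hσc, hc1, hbc⟩
    -- y := b − (φ c − c) is fixed and of norm < 1, hence divisible by 2 in 𝒪_F
    set y : L := b - (φ c - c) with hy
    have hσy : σ y = y := by
      rw [hy, map_sub, map_sub, hσb, hcomm, hσc]
    have hy1 : ‖y‖ < 1 := by
      have e : y = ((b - (c ^ 2 + c)) + (c ^ 2 - φ c)) + 2 * c := by rw [hy]; ring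
      rw [e]
      refine lt_of_le_of_lt (IsUltrametricDist.norm_add_le_max _ _) (max_lt ?_ ?_)
      · refine lt_of_le_of_lt (IsUltrametricDist.norm_add_le_max _ _) (max_lt hbc ?_)
        rw [← norm_neg, neg_sub]; exact hfrob c hσc hc1
      · rw [norm_mul]
        calc ‖(2 : L)‖ * ‖c‖ ≤ ‖(2 : L)‖ * 1 := by gcongr
          _ < 1 := by rw [mul_one]; exact norm_two_lt_one
    have hy2 : ‖y‖ ≤ ‖(2 : L)‖ := hunr y hσy hy1
    refine ⟨y / 2, ⟨?_, ?_⟩, c, ⟨hσc, hc1⟩, ?_⟩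
    · rw [map_div₀, map_ofNat, hσy]
    · rw [norm_div, div_le_one (by rw [norm_two]; norm_num)]; exact hy2
    · rw [mul_div_cancel₀ _ two_ne_zero_L, hy]; ring
  · rintro ⟨x, ⟨hσx, hx1⟩, c, ⟨hσc, hc1⟩, rfl⟩
    refine ⟨?_, c, hσc, hc1, ?_⟩
    · rw [map_add, map_mul, map_ofNat, hσx, map_sub, hcomm, hσc]
    · have e : 2 * x + (φ c - c) - (c ^ 2 + c) = (2 * x + (φ c - c ^ 2)) + (-(2 * c)) := by ring
      rw [e]
      refine lt_of_le_of_lt (IsUltrametricDist.norm_add_le_max _ _) (max_lt ?_ ?_)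
      · refine lt_of_le_of_lt (IsUltrametricDist.norm_add_le_max _ _) (max_lt ?_ (hfrob c hσc hc1))
        rw [norm_mul]
        calc ‖(2 : L)‖ * ‖x‖ ≤ ‖(2 : L)‖ * 1 := by gcongr
          _ < 1 := by rw [mul_one]; exact norm_two_lt_one
      · rw [norm_neg, norm_mul]
        calc ‖(2 : L)‖ * ‖c‖ ≤ ‖(2 : L)‖ * 1 := by gcongr
          _ < 1 := by rw [mul_one]; exact norm_two_lt_one

end LevelOne

end Summit.BirchSwinnertonDyer.BirchSwinnertonDyer.Cruxes.SplitBadTwoLowerHalfOfFacts.LevelsToLambdaK3G32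

end
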